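import Mathlib

/-!
# Lexicographic products of ladders — explicit / elementary proof (siege k18)

Item `stmt-MatrixMultiplication-14308` (`FourierTwoFamiliesModP.PrimeTwoFamilies`, CKSU 2005
Conj. 4.7 with prime cyclic hosts), line `Sketch`, registered stub `isLadder_lexProd`;
siege attempt k18, variation "explicit / elementary route".

A LADDER is an ordered family `(X c, Y c)_{c < r}` of finite subsets of an abelian group with

* (directness, `hW`) `(x - x') + (y - y') = 0` forces `x = x'`, `y = y'` inside each class;
* (one-directional separation, `hL`) for `p < q` no lower cross difference `y' - x'`
  (`x' ∈ X p`, `y' ∈ Y q`) equals a diagonal difference `y - x` (`x ∈ X c`, `y ∈ Y c`).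

The stub says that ladders are closed under LEXICOGRAPHIC products: index the classes of the
product by `c : Fin (r₁ * r₂)` and put `X c = X₁ c.divNat ×ˢ X₂ c.modNat ⊆ G₁ × G₂` (likewise `Y`).

The proof here is by explicit mixed-radix arithmetic, in three self-contained steps:

1. `radix_lt_iff` — for digits `m₁, m₂ < n` the numbers `n * d₁ + m₁`, `n * d₂ + m₂` compare
   exactly as the pairs `(d₁, m₁)`, `(d₂, m₂)` compare lexicographically (pure `ℕ`, no division);
2. `lt_iff_divNat_modNat` — since `c = r₂ * c.divNat + c.modNat` (`Nat.div_add_mod`), the order of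
   `Fin (r₁ * r₂)` IS the lexicographic order of the coordinates `(divNat, modNat)`;
3. `isLadder_lexProd` — write every point of `G₁ × G₂` in coordinates: directness splits into the
   two coordinate equations, and for `p < q` separation holds in the first coordinate when
   `p.divNat < q.divNat` (by `hL₁`) and in the second when `p.divNat = q.divNat`,
   `p.modNat < q.modNat` (by `hL₂`, which only sees the second coordinates).

Mathlib only; no `omega`/`decide`.
-/

-- single-conjunct summit: the mandated namespace repeats `MatrixMultiplication` (summit = sub-problem).
set_option linter.dupNamespace false

namespace Summit.MatrixMultiplication.MatrixMultiplication.Theorems.PrimeTwoFamilies.LadderLexProdK18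

/-- **Mixed-radix comparison.**  For digits `m₁, m₂ < n`, the two-digit numbers `n * d₁ + m₁` and
`n * d₂ + m₂` compare exactly as the digit pairs `(d₁, m₁)` and `(d₂, m₂)` compare
lexicographically. -/
theorem radix_lt_iff {n d₁ m₁ d₂ m₂ : ℕ} (hm₁ : m₁ < n) (hm₂ : m₂ < n) :
    n * d₁ + m₁ < n * d₂ + m₂ ↔ d₁ < d₂ ∨ (d₁ = d₂ ∧ m₁ < m₂) := by
  -- the one genuinely arithmetic fact: a strictly smaller leading digit wins, whatever the
  -- trailing digits are.
  have carry : ∀ {d d' m m' : ℕ}, m < n → d < d' → n * d + m < n * d' + m' :=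
    fun {d d' m m'} hm hd =>
      calc n * d + m < n * d + n := Nat.add_lt_add_left hm _
        _ = n * (d + 1) := by ring
        _ ≤ n * d' := Nat.mul_le_mul_left n (Nat.succ_le_of_lt hd)
        _ ≤ n * d' + m' := Nat.le_add_right _ _
  constructor
  · intro h
    rcases lt_trichotomy d₁ d₂ with hlt | rfl | hgt
    · exact Or.inl hlt
    · exact Or.inr ⟨rfl, Nat.lt_of_add_lt_add_left h⟩
    · exact absurd h (Nat.lt_asymm (carry hm₂ hgt))
  · rintro (hlt | ⟨rfl, hm⟩)
    · exact carry hm₁ hlt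
    · exact Nat.add_lt_add_left hm _

/-- **The order of `Fin (r₁ * r₂)` is lexicographic in `(divNat, modNat)`.**  Explicitly,
`p = r₂ * p.divNat + p.modNat` with `p.modNat < r₂`, so `radix_lt_iff` applies. -/
theorem lt_iff_divNat_modNat {r₁ r₂ : ℕ} (p q : Fin (r₁ * r₂)) :
    p < q ↔ p.divNat < q.divNat ∨ (p.divNat = q.divNat ∧ p.modNat < q.modNat) := by
  have key := radix_lt_iff (d₁ := (p : ℕ) / r₂) (d₂ := (q : ℕ) / r₂) p.modNat.is_lt q.modNat.is_lt
  rw [Fin.coe_modNat, Fin.coe_modNat, Nat.div_add_mod, Nat.div_add_mod] at key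
  rw [Fin.lt_def, Fin.lt_def, Fin.lt_def, Fin.ext_iff, Fin.coe_divNat, Fin.coe_divNat,
    Fin.coe_modNat, Fin.coe_modNat]
  exact key

/-- **Lexicographic products of ladders are ladders** (registered stub `isLadder_lexProd`).
If `(X₁ c, Y₁ c)_{c < r₁}` is a ladder in `G₁` (`hW₁`: each class direct; `hL₁`: one-directionally
separated) and `(X₂ c, Y₂ c)_{c < r₂}` is a ladder in `G₂` (`hW₂`, `hL₂`), then the family indexed
by `c : Fin (r₁ * r₂)` with classes `X₁ c.divNat ×ˢ X₂ c.modNat` and `Y₁ c.divNat ×ˢ Y₂ c.modNat`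
in `G₁ × G₂` is a ladder: every class is direct (first conjunct) and the family is
one-directionally separated (second conjunct). -/
theorem isLadder_lexProd {G₁ G₂ : Type*} [AddCommGroup G₁] [AddCommGroup G₂] {r₁ r₂ : ℕ}
    (X₁ Y₁ : Fin r₁ → Finset G₁) (X₂ Y₂ : Fin r₂ → Finset G₂)
    (hW₁ : ∀ c : Fin r₁, ∀ x ∈ X₁ c, ∀ x' ∈ X₁ c, ∀ y ∈ Y₁ c, ∀ y' ∈ Y₁ c,
      (x - x') + (y - y') = 0 → x = x' ∧ y = y')
    (hL₁ : ∀ c p q : Fin r₁, p < q → ∀ x ∈ X₁ c, ∀ y ∈ Y₁ c, ∀ x' ∈ X₁ p, ∀ y' ∈ Y₁ q,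
      y - x ≠ y' - x')
    (hW₂ : ∀ c : Fin r₂, ∀ x ∈ X₂ c, ∀ x' ∈ X₂ c, ∀ y ∈ Y₂ c, ∀ y' ∈ Y₂ c,
      (x - x') + (y - y') = 0 → x = x' ∧ y = y')
    (hL₂ : ∀ c p q : Fin r₂, p < q → ∀ x ∈ X₂ c, ∀ y ∈ Y₂ c, ∀ x' ∈ X₂ p, ∀ y' ∈ Y₂ q,
      y - x ≠ y' - x') :
    (∀ c : Fin (r₁ * r₂), ∀ x ∈ X₁ c.divNat ×ˢ X₂ c.modNat, ∀ x' ∈ X₁ c.divNat ×ˢ X₂ c.modNat,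
        ∀ y ∈ Y₁ c.divNat ×ˢ Y₂ c.modNat, ∀ y' ∈ Y₁ c.divNat ×ˢ Y₂ c.modNat,
        (x - x') + (y - y') = 0 → x = x' ∧ y = y') ∧
    (∀ c p q : Fin (r₁ * r₂), p < q →
        ∀ x ∈ X₁ c.divNat ×ˢ X₂ c.modNat, ∀ y ∈ Y₁ c.divNat ×ˢ Y₂ c.modNat,
        ∀ x' ∈ X₁ p.divNat ×ˢ X₂ p.modNat, ∀ y' ∈ Y₁ q.divNat ×ˢ Y₂ q.modNat, y - x ≠ y' - x') := by
  refine ⟨?_, ?_⟩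
  · -- directness, in coordinates
    rintro c ⟨x₁, x₂⟩ hx ⟨x₁', x₂'⟩ hx' ⟨y₁, y₂⟩ hy ⟨y₁', y₂'⟩ hy' h
    simp only [Finset.mem_product] at hx hx' hy hy'
    simp only [Prod.mk_sub_mk, Prod.mk_add_mk, Prod.mk_eq_zero] at h
    obtain ⟨rfl, rfl⟩ := hW₁ c.divNat x₁ hx.1 x₁' hx'.1 y₁ hy.1 y₁' hy'.1 h.1
    obtain ⟨rfl, rfl⟩ := hW₂ c.modNat x₂ hx.2 x₂' hx'.2 y₂ hy.2 y₂' hy'.2 h.2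
    exact ⟨rfl, rfl⟩
  · -- one-directional separation, in coordinates, along the lexicographic case split
    rintro c p q hpq ⟨x₁, x₂⟩ hx ⟨y₁, y₂⟩ hy ⟨x₁', x₂'⟩ hx' ⟨y₁', y₂'⟩ hy' h
    simp only [Finset.mem_product] at hx hy hx' hy'
    simp only [Prod.mk_sub_mk, Prod.mk.injEq] at h
    rcases (lt_iff_divNat_modNat p q).1 hpq with hd | ⟨-, hm⟩
    · exact hL₁ c.divNat p.divNat q.divNat hd x₁ hx.1 y₁ hy.1 x₁' hx'.1 y₁' hy'.1 h.1
    · exact hL₂ c.modNat p.modNat q.modNat hm x₂ hx.2 y₂ hy.2 x₂' hx'.2 y₂' hy'.2 h.2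

end Summit.MatrixMultiplication.MatrixMultiplication.Theorems.PrimeTwoFamilies.LadderLexProdK18
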